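import Summits.CriticalPhenomena.PercolationContinuityZ3.Theorems.PercNearOneGluingNoHeavyLowerTailSahiMixtureChainMoments
import Summits.CriticalPhenomena.PercolationContinuityZ3.Theorems.PercNearOneGluingNoHeavyLowerTailSahiMixtureTopRowSquare
import Literature.Combinatorics.Sahi2008.Indicators
import Literature.Combinatorics.Sahi2008.Chains
import HarnessLib

/-!
# Mixing a chain weight toward its top point is Bernstein-positive for `E_n`; hence the TOP cell of every
# monotone mixture of product measures is Bernstein-positive at every order

Support file of the one-cut programme (crux `NoHeavyLowerTail`, stmt-CriticalPhenomena-4575; cell `prim-masterthm`, seat P3, gen 15;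
`run/shared/lean/prim/prim-masterthm/prim-masterthm-p3/HIERARCHY.md` §23; memo
`run/shared/lean/prim/prim-masterthm/FROM-prim-masterthm-p3-g15-MONOTONE-MIXTURES.md` §3(c)).

THE CHAIN THEOREM (`bernsteinPos_sahiE_mixTop_of_linearOrder`).  On a finite chain `α` with a top element `⊤`, for every probability weight `ν`, every
`n` and all nonnegative monotone `f_0,…,f_{n−1}`, the function `h ↦ E_n^{(1−h)ν + h·δ_⊤}(f_0,…,f_{n−1})` is Bernstein-positive of degree `n` (a nonnegative
combination of `h^j(1−h)^{n−j}` on `[0,1]`).  Proof: finite layer cake and multilinearity (the tree's `exists_upperSet_decomposition`, `sahiE_update_listSum`)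
reduce to indicators of up-sets; up-sets of a chain are nested and all contain `⊤`, so after sorting the slots (`sahiE_comp_perm`) the Lieb–Sahi/Blinovsky
product formula (`sahiE_chain`) writes `E_n` as a product of factors `(k − i) − ((1−h)ν(U_i) + h) = (1−h)((k−i) − ν(U_i)) + h(k−i−1)` and `(1−h)ν(U_k) + h`,
each affine in `h` with nonnegative endpoint values — so the product is Bernstein-positive (`BernsteinPos.finProd`).

THE CONSEQUENCE (`bernsteinPos_orCoin_all_of_chainMoments`).  For events `A_0,…,A_{n−1}` with CHAIN MOMENTS (`…SahiMixtureChainMoments`: conditionally independent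
given a latent level with co-monotone conditional probabilities `y_{l,i} ∈ [0,1]` — monotone mixtures of product measures, de Finetti laws, one-factor
threshold models), OR-ing an independent coin of bias `h` into ALL members gives `h ↦ E_m(μ ⊗ coin(h); 1_{A_{s 0}∪H},…,1_{A_{s(m−1)}∪H})` BERNSTEIN-POSITIVE
of degree `m`, for EVERY `m` and every `m` distinct members: by moment transfer (`sahiE_congr_of_moments`) this is the chain theorem on `Fin (L+1)` for the
weight `(1−h)·(w,0) + h·δ_last` and the functions `l ↦ y_{l,s j}` topped by `1`.  This is the conclusion of `TopRowConjecture` on this class, at every order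
(gen 13/14 had it for all laws at `m ≤ 6` in Lean, `≤ 10` by census; gen 15 showed its N-form fails at `m = 58`).
HONEST FRAMING: nothing here asserts (M⁺-k) or `C_k` for `k ≥ 3`; partial OR cells (`|G| < m`) and general increasing events of these laws are not covered.
Everything PROVED, standard axioms, definition-free. [this work]
-/

noncomputable section

open scoped Classical

namespace Summit.CriticalPhenomena.PercolationContinuityZ3.Theorems

open Finset Function
open Literature.Combinatorics.Sahi2008
open Literature.Probability.Percolation.DecisionTree (ind ind_of_mem ind_of_not_mem ind_nonneg)

namespace SahiMixture

/-! ### Bernstein positivity of list sums -/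

/-- A list sum of nonnegative multiples of Bernstein-positive functions is Bernstein-positive. [folklore] -/
theorem bernsteinPos_listSum {β : Type*} {m : ℕ} (Φ : β → ℝ → ℝ) :
    ∀ l : List (ℝ × β), (∀ p ∈ l, 0 ≤ p.1 ∧ BernsteinPos m (Φ p.2)) →
      BernsteinPos m (fun h => (l.map fun p => p.1 * Φ p.2 h).sum)
  | [], _ => by simpa using bernsteinPos_const m le_rfl
  | p :: l, hl => by
    have hp := hl p (by simp)
    have ih := bernsteinPos_listSum Φ l fun q hq => hl q (by simp [hq])
    have := (hp.2.smul hp.1).add ih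
    refine this.congr fun h _ _ => ?_
    simp [List.map_cons, List.sum_cons]

/-! ### The chain theorem -/

section Chain

variable {α : Type*} [Fintype α] [LinearOrder α]

omit [Fintype α] [LinearOrder α] in
/-- A `⊆`-comparable family of finite sets can be re-indexed by a permutation into a decreasing chain (sort by cardinality).  Plumbing
(the tree's version in `Sahi2008/TotalOrder.lean` is private). [folklore] -/
theorem exists_perm_antitone_of_total {n : ℕ} (U : Fin n → Finset α) (hU : ∀ i j, U i ⊆ U j ∨ U j ⊆ U i) :
    ∃ σ : Equiv.Perm (Fin n), ∀ i j : Fin n, i ≤ j → U (σ j) ⊆ U (σ i) := by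
  let τ : Equiv.Perm (Fin n) := Tuple.sort fun i => (U i).card
  have hmono : Monotone ((fun i => (U i).card) ∘ τ) := Tuple.monotone_sort _
  refine ⟨Fin.revPerm.trans τ, fun i j hij => ?_⟩
  have hcard : (U (τ (Fin.rev j))).card ≤ (U (τ (Fin.rev i))).card := hmono (Fin.rev_le_rev.2 hij)
  simp only [Equiv.trans_apply, Fin.revPerm_apply]
  rcases hU (τ (Fin.rev j)) (τ (Fin.rev i)) with h | h
  · exact h
  · exact Finset.subset_of_eq (Finset.eq_of_subset_of_card_le h hcard).symm

/-- The mixed weight `(1−h)·ν + h·δ_top`. (Local abbreviation as a plain function; no definition is introduced.) [folklore] -/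
theorem ex_mixTop (ν : α → ℝ) (top : α) (h : ℝ) (f : α → ℝ) :
    ex (fun x => (1 - h) * ν x + h * (if x = top then 1 else 0)) f = (1 - h) * ex ν f + h * f top := by
  simp only [ex_def, add_mul, Finset.sum_add_distrib, mul_assoc, ← Finset.mul_sum]
  congr 1
  rw [Finset.sum_eq_single top (fun x _ hx => by simp [hx]) (fun hx => absurd (Finset.mem_univ top) hx)]
  simp

/-- **Indicator case of the chain theorem**: for up-sets `U_0,…,U_n` of a finite chain with top element `top` (so every nonempty up-set contains `top`)
and a probability weight `ν`, `h ↦ E_{n+1}^{(1−h)ν + hδ_top}(1_{U_0},…,1_{U_n})` is Bernstein-positive of degree `n+1` — by the product formula on the sorted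
(nested) family, each factor being affine in `h` with nonnegative endpoint values. [this work] -/
theorem bernsteinPos_sahiE_mixTop_setInd (ν : α → ℝ) (hν0 : ∀ x, 0 ≤ ν x) (hν1 : ∑ x, ν x = 1)
    (top : α) (htop : ∀ x, x ≤ top) (n : ℕ) (U : Fin (n + 1) → Finset α) (hU : ∀ i, IsUpperSet ((U i : Finset α) : Set α)) :
    BernsteinPos (n + 1) (fun h => sahiE (fun x => (1 - h) * ν x + h * (if x = top then 1 else 0)) (n + 1) (fun i => setInd (U i))) := by
  -- either some `U i` is empty (then `E ≡ 0`), or all contain `top`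
  by_cases hem : ∃ i, U i = ∅
  · obtain ⟨i, hi⟩ := hem
    refine (bernsteinPos_const (n + 1) le_rfl).congr fun h _ _ => ?_
    have hz : (fun j => setInd (U j)) = update (fun j => setInd (U j)) i 0 := by
      funext j
      by_cases hji : j = i
      · subst hji; rw [update_self, hi]; funext x; simp [setInd_apply]
      · rw [update_of_ne hji]
    rw [hz, sahiE_update_zero]
  have htopmem : ∀ i, top ∈ U i := by
    intro i
    obtain ⟨x, hx⟩ := Finset.nonempty_iff_ne_empty.2 (fun hi => hem ⟨i, hi⟩)
    exact hU i (htop x) hx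
  -- sort the slots into a decreasing chain
  have htot : ∀ i j, U i ⊆ U j ∨ U j ⊆ U i := fun i j => by
    rcases (hU i).total (hU j) with h | h
    · exact Or.inl (Finset.coe_subset.1 h)
    · exact Or.inr (Finset.coe_subset.1 h)
  obtain ⟨σ, hσ⟩ := exists_perm_antitone_of_total U htot
  have hperm : ∀ μ : α → ℝ, sahiE μ (n + 1) (fun i => setInd (U i)) = sahiE μ (n + 1) (fun i => setInd (U (σ i))) :=
    fun μ => (sahiE_comp_perm μ (n + 1) σ (fun i => setInd (U i))).symm
  -- absorbing chain for the sorted family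
  have habs : ∀ i j : Fin (n + 1), i < j → setInd (U (σ j)) * setInd (U (σ i)) = setInd (U (σ j)) := by
    intro i j hij
    rw [setInd_mul, Finset.inter_eq_left.2 (hσ i j hij.le)]
  -- the moments of indicators of sets containing `top`
  have hexU : ∀ (h : ℝ) (i : Fin (n + 1)),
      ex (fun x => (1 - h) * ν x + h * (if x = top then 1 else 0)) (setInd (U (σ i))) = (1 - h) * ex ν (setInd (U (σ i))) + h := by
    intro h i
    rw [ex_mixTop, setInd_apply, if_pos (htopmem (σ i)), mul_one]
  have ha0 : ∀ i, 0 ≤ ex ν (setInd (U (σ i))) := fun i => ex_nonneg hν0 fun x => setInd_nonneg _ _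
  have ha1 : ∀ i, ex ν (setInd (U (σ i))) ≤ 1 := fun i => by
    calc ex ν (setInd (U (σ i))) ≤ ex ν (fun _ => (1 : ℝ)) := ex_mono hν0 fun x => by
            rw [setInd_apply]; split_ifs <;> norm_num
      _ = 1 := ex_const hν1 1
  -- the product of affine Bernstein-positive factors
  have hfac : BernsteinPos n (fun h => ∏ i : Fin n, (((n : ℝ) - (i : ℕ)) - ((1 - h) * ex ν (setInd (U (σ i.castSucc))) + h))) := by
    refine BernsteinPos.finProd n _ fun i => ?_
    have hi : ((i : ℕ) : ℝ) + 1 ≤ (n : ℝ) := by exact_mod_cast Nat.succ_le_of_lt i.isLt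
    refine (bernsteinPos_affine (x := (n : ℝ) - (i : ℕ) - ex ν (setInd (U (σ i.castSucc)))) (y := (n : ℝ) - (i : ℕ) - 1)
      (by linarith [ha1 i.castSucc]) (by linarith)).congr fun h _ _ => ?_
    ring
  have hlast : BernsteinPos 1 (fun h => (1 - h) * ex ν (setInd (U (σ (Fin.last n)))) + h) :=
    (bernsteinPos_affine (ha0 (Fin.last n)) zero_le_one).congr fun h _ _ => by ring
  refine (BernsteinPos.mul hfac hlast).congr fun h _ _ => ?_
  rw [hperm, sahiE_chain _ n (fun i => setInd (U (σ i))) habs]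
  simp only [hexU]

/-- Slot-by-slot layer cake behind the chain theorem (the tree's `sahiE_nonneg_of_indicators_aux` with the predicate "Bernstein-positive in the mixing
parameter" in place of "nonnegative"). [this work] -/
theorem bernsteinPos_sahiE_mixTop_aux (ν : α → ℝ) (hν0 : ∀ x, 0 ≤ ν x) (hν1 : ∑ x, ν x = 1) (top : α) (htop : ∀ x, x ≤ top) (n : ℕ) :
    ∀ (m : ℕ) (f : Fin (n + 1) → α → ℝ), (∀ i x, 0 ≤ f i x) → (∀ i, Monotone (f i)) →
      (∀ i : Fin (n + 1), m ≤ i.val → ∃ U : Finset α, IsUpperSet ((U : Finset α) : Set α) ∧ f i = setInd U) →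
      BernsteinPos (n + 1) (fun h => sahiE (fun x => (1 - h) * ν x + h * (if x = top then 1 else 0)) (n + 1) f)
  | 0, f, _, _, hind => by
    choose U hU hfU using fun i => hind i (Nat.zero_le _)
    have hf : f = fun i => setInd (U i) := funext hfU
    rw [hf]
    exact bernsteinPos_sahiE_mixTop_setInd ν hν0 hν1 top htop n U hU
  | m + 1, f, hf, hmono, hind => by
    by_cases hm : m < n + 1
    · let i : Fin (n + 1) := ⟨m, hm⟩
      obtain ⟨l, hl, hfl⟩ := exists_upperSet_decomposition (f i) (hf i) (hmono i)
      have key := bernsteinPos_listSum (m := n + 1)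
        (fun (V : Finset α) (h : ℝ) => sahiE (fun x => (1 - h) * ν x + h * (if x = top then 1 else 0)) (n + 1) (update f i (setInd V)))
        l ?_
      · refine key.congr fun h _ _ => ?_
        show sahiE _ (n + 1) f = _
        conv_lhs => rw [← update_eq_self i f, hfl]
        rw [sahiE_update_listSum]
      · intro p hp
        refine ⟨(hl p hp).1, bernsteinPos_sahiE_mixTop_aux ν hν0 hν1 top htop n m _ ?_ ?_ ?_⟩
        · intro j x
          by_cases hji : j = i
          · subst hji; rw [update_self]; exact setInd_nonneg _ _
          · rw [update_of_ne hji]; exact hf j x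
        · intro j
          by_cases hji : j = i
          · subst hji; rw [update_self]; exact monotone_setInd (hl p hp).2
          · rw [update_of_ne hji]; exact hmono j
        · intro j hmj
          by_cases hji : j = i
          · subst hji
            exact ⟨p.2, (hl p hp).2, by rw [update_self]⟩
          · have hij : m + 1 ≤ j.val := by
              have : j.val ≠ m := fun hv => hji (Fin.ext hv)
              omega
            obtain ⟨U, hU, hjU⟩ := hind j hij
            exact ⟨U, hU, by rw [update_of_ne hji]; exact hjU⟩
    · exact bernsteinPos_sahiE_mixTop_aux ν hν0 hν1 top htop n m f hf hmono fun i hi => absurd hi (by omega)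

/-- **The chain theorem.**  On a finite chain with top element `top`, for every probability weight `ν`, every `n` and all nonnegative monotone
`f_0,…,f_{n−1}`: `h ↦ E_n^{(1−h)ν + hδ_top}(f_0,…,f_{n−1})` is Bernstein-positive of degree `n` (mixing the weight toward the top point).  Layer cake +
sorted product formula; each factor affine in `h` with nonnegative endpoints. [this work] -/
theorem bernsteinPos_sahiE_mixTop_of_linearOrder (ν : α → ℝ) (hν0 : ∀ x, 0 ≤ ν x) (hν1 : ∑ x, ν x = 1)
    (top : α) (htop : ∀ x, x ≤ top) (n : ℕ) (f : Fin n → α → ℝ) (hf : ∀ i x, 0 ≤ f i x) (hmono : ∀ i, Monotone (f i)) :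
    BernsteinPos n (fun h => sahiE (fun x => (1 - h) * ν x + h * (if x = top then 1 else 0)) n f) := by
  rcases n with _ | n
  · simpa [sahiE_zero] using bernsteinPos_const 0 le_rfl
  · exact bernsteinPos_sahiE_mixTop_aux ν hν0 hν1 top htop n (n + 1) f hf hmono fun i hi => absurd hi (by omega)

end Chain

/-! ### The TOP cell under chain moments is Bernstein-positive at every order -/

section ChainMoments

variable {α : Type*} [Fintype α] {L n : ℕ}

/-- **Bernstein positivity of the all-members OR-coin cell under chain moments, every order.**  Events `A_0,…,A_{n−1}` whose distinct-index moments
are `E[Π_r 1_{A_{e r}}] = Σ_l w_l Π_r y_{l,e r}` (`w ≥ 0` of mass `1`, `0 ≤ y ≤ 1`, `y_{·,i}` nondecreasing): for `h ∈ [0,1]`, every `m` and every injective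
`s : Fin m → Fin n`, `h ↦ E_m(μ ⊗ coin(h); 1_{A_{s 0}∪H},…,1_{A_{s(m−1)}∪H})` is Bernstein-positive of degree `m`.  Proof: for each `h` the cell equals (moment
transfer) `E_m` of the functions `l ↦ y_{l,s j}` topped by `1` on the chain `Fin (L+1)` under the weight `(1−h)·(w,0) + h·δ_last`; then the chain theorem.
The conclusion of `TopRowConjecture` on the class of monotone mixtures of product measures, uniformly in `m`. [this work] -/
theorem bernsteinPos_orCoin_all_of_chainMoments (μ : α → ℝ) (hμ1 : ∑ a, μ a = 1) (A : Fin n → Set α)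
    (w : Fin L → ℝ) (hw0 : ∀ l, 0 ≤ w l) (hw1 : ∑ l, w l = 1)
    (y : Fin L → Fin n → ℝ) (hy0 : ∀ l i, 0 ≤ y l i) (hy1 : ∀ l i, y l i ≤ 1) (hmono : ∀ i, Monotone (fun l => y l i))
    (hmom : ∀ (k : ℕ) (e : Fin k → Fin n), Function.Injective e →
      ex μ (∏ r, ind (A (e r))) = ∑ l, w l * ∏ r, y l (e r))
    {m : ℕ} (s : Fin m → Fin n) (hs : Function.Injective s) :
    BernsteinPos m (fun h => sahiE (coinWeight μ h) m (fun j => ind (orCoin (A (s j)) true))) := by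
  -- the chain `Fin (L+1)`, base weight `(w, 0)`, top `Fin.last L`, functions `l ↦ y l (s j)` topped by `1`
  let ν : Fin (L + 1) → ℝ := Fin.snoc w 0
  let g : Fin m → Fin (L + 1) → ℝ := fun j => Fin.snoc (fun l => y l (s j)) 1
  have hν0 : ∀ a, 0 ≤ ν a := by
    intro a
    rcases Fin.eq_castSucc_or_eq_last a with ⟨a', rfl⟩ | rfl
    · simp only [ν, Fin.snoc_castSucc]; exact hw0 a'
    · simp only [ν, Fin.snoc_last]; exact le_rfl
  have hν1 : ∑ a, ν a = 1 := by
    simp only [ν, Fin.sum_univ_castSucc, Fin.snoc_castSucc, Fin.snoc_last, hw1, add_zero]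
  have hg0 : ∀ j a, 0 ≤ g j a := by
    intro j a
    rcases Fin.eq_castSucc_or_eq_last a with ⟨a', rfl⟩ | rfl
    · simp only [g, Fin.snoc_castSucc]; exact hy0 a' (s j)
    · simp only [g, Fin.snoc_last]; exact zero_le_one
  have hgm : ∀ j, Monotone (g j) := fun j => monotone_snoc_of_le (hmono (s j)) fun l => hy1 l (s j)
  have key := bernsteinPos_sahiE_mixTop_of_linearOrder ν hν0 hν1 (Fin.last L) Fin.le_last m g hg0 hgm
  refine key.congr fun h _ _ => ?_
  -- moment transfer, for this `h`
  refine sahiE_congr_of_moments (coinWeight μ h) _ (fun j => ind (orCoin (A (s j)) true)) g ?_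
  intro k e he
  rw [show (∏ r, ind (orCoin (A (s (e r))) true)) = ∏ r, ind (orCoin (A ((s ∘ e) r)) true) from rfl,
    ex_coinWeight_prod_ind_orCoin_all μ hμ1 A h (s ∘ e), hmom k (s ∘ e) (hs.comp he), ex_mixTop, ex_def,
    Fin.sum_univ_castSucc]
  simp only [ν, g, Fin.snoc_castSucc, Fin.snoc_last, Finset.prod_apply, Function.comp, Finset.prod_const_one, mul_one,
    add_zero, Finset.mul_sum]

end ChainMoments

end SahiMixture

end Summit.CriticalPhenomena.PercolationContinuityZ3.Theorems

end
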